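import Summits.QuantumFields.BalabanUV.Beta.FP.NestedStepLawTorusComposite
import Summits.QuantumFields.BalabanUV.Beta.FP.TorusCompositeObjectsG
import Summits.QuantumFields.BalabanUV.Beta.FP.TorusEffFormCompositeG
import Summits.QuantumFields.BalabanUV.Beta.FP.RelInvPeriodisedCombTorusLetters
import Summits.QuantumFields.BalabanUV.Beta.FP.RelInvPeriodisedCombRecord

/-!
# `BalabanUV.Beta.FP.NestedStepLawTorusCompositeG` — road «FP» for binder row D1, ROUTE T under RULING R-D1-g52-1 (β1) (journal l.56283) ∕ R-FP-70 (l.56383):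
# **#19's GRADED TORUS CALL AT FINE := THE `(n+1)`-FOLD COMPOSITE, GENERIC OVER THE ONE-STEP ROW FAMILY `Q : StepRows d Lc` AND THE ONE-STEP FORM KERNEL
# FAMILY `K ℓ r`** — the `-G` edition of `NestedStepLawTorusComposite.secondVar_oneShot_nestedStepLaw_torus_composite_graded` (p-landed, this road gen 19):
# the rooted instance (`Q := Qstep Lc`, `K ℓ r := bhKStepAt d (toSite r) Lc ℓ`) IS #19 (consistency `example`, §2), the (0.4)-SYMMETRISED instance
# (`Q := QSym Lc`, `K ℓ _ := bhKStepSh d Lc (Dsh Lc) ℓ`, roots `ctrOff`) IS the re-based tower's call (§3)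

WHY (R-D1-g52-1 (3)(b)(c): «the composite tower is RE-BASED on an1's (0.4)-symmetrised bricks at the centred root … → the OWNER d1-p3: the 4 mechanical
re-compositions (#19(+Gen) ∕ #20 ∕ #21) AFTER the suppliers»; R-FP-70: the re-compositions are `-G` editions generic over `(Q, K)` with brick inputs DISPLAYED).
#19's proof is [folklore] block algebra over leaf-06's `NestedStepLawTransportedExpGraded` graded law; its ONLY brick-specific inputs are (i) `H₀ᵀ = H₀` at the finest
level, (ii) leaf-05's (INV-m)(EFF-m) joint induction, (iii) the top step's comb-sliced KKT non-degeneracy.  THIS FILE displays (i) as `hH₀t`, feeds (ii) from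
leaf-05's GENERIC `TorusEffFormCompositeG.torus_composite_inv_and_eff_G` (its one-step letters (h1)ₖ ∕ (hId)ₖ displayed as `hone ∕ hId`), and displays (iii) as
`htop` over an ABSTRACT top step `Q₂₀ ∕ τ₂`; the pins read leaf-06's `TorusCompositeObjectsG.compRowsG ∕ nestedSliceG` and the abstract form family `K`.
Everything else is #19 VERBATIM (binders, (SLICE-m)(COV-m)(T-β-m)(WARD-m) rows displayed, conclusion).  §2: the ROOTED instance recovers #19's statement
character for character (`example`; `compRows_eq_compRowsG ∕ nestedSlice_eq_nestedSliceG`, `H₀_transpose_of_dvd`, leaf-05's `torus_h1 ∕ hId_order_zero_record`,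
`torus_isUnit_det_kkt_combRows`).  §3: the SYM instance `…_sym` at `Q := QSym Lc`, `K ℓ _ := bhKStepSh d Lc (Dsh Lc) ℓ`, `rs := fun _ => ctrOff (d+1) Lc`,
with `hH₀t ∕ hone ∕ hId ∕ htop` DISCHARGED by leaf-05's chart-(III′) letters `torus_H₀_transpose_comb ∕ torus_h1_comb ∕ hId_comb ∕ torus_isUnit_det_kkt_combRows_comb`
— the top step in (B)'s slot presentation.  [folklore] composition BY NAME; no `def`, no `def … : Prop`, nothing cited, 0 sorry.  The rows, legs and namings are
HYPOTHESES (nothing of the dictionary ∕ Bałaban's asserted; the presentation is the row's (β1) ruling, quoted not adjudicated).  No existing file touched.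

HONEST DEPENDENCY (page 1, mandatory): continuum YM on T⁴ ⇐ BetaPertH ∧ nine spine estimates (0/9 proved); BetaPertH ⇐ (D1) ∧ (D4) ∧ CAP+tail;
G-an2-4 gates asym, D1 and NE2/3/4.  HONEST FRAMING (cell contract, verbatim): «discharging `BetaPertH` makes Bałaban's UV stability UNCONDITIONAL —
a real constructive-QFT result; it is NOT the continuum limit and NOT the Clay problem.»  ABSOLUTE RULE (cell charter, verbatim): «No internally-minted
statement may enter as a cited fact. Every hypothesis is either kernel-proved in this package or a verbatim quotation of a PUBLISHED theorem with page
reference. The manuscript(s) under audit are NOT citable for their own disputed steps — they are the thing under adjudication; programme-internal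
(2001/route/tribunal) claims are never citable.»  0 estimates; 0∕4 row-D1 binders (hW, hR, D1Tel, D1Rep); ROOT M‴ p325680 untouched; NOT (C1), NOT (L2′),
NOT (T-ID), NOT SDF, NOT D1, NOT BetaPertH, NOT continuum, NOT Clay.  Road «FP» OWNER, b2b-balaban-beta-d1-p3 gen 29, 2026-08-24.  No existing file touched.
-/

noncomputable section

namespace Summit.QuantumFields.BalabanUV.Beta.FP.NestedStepLawTorusCompositeG

open Matrix
open Literature.MathematicalPhysics.QuantumFieldTheory.Balaban1983to89
open Literature.MathematicalPhysics.QuantumFieldTheory.Balaban1983to89.Beta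
open Literature.MathematicalPhysics.QuantumFieldTheory.Balaban1983to89.Beta.Composition (kkt)
open Literature.MathematicalPhysics.QuantumFieldTheory.Balaban1983to89.Beta.CompositionSingular (effForm flucCov minOp minOpL)
open B5Prop11Plancherel (fine)
open B6Lemma24Torus (pbox mem_pbox)
open AffineAveraging (Site box toSite)
open OneStepResolventKernel (Fib)
open Summit.QuantumFields.BalabanUV.Beta.BorderedHessian (bhKStepAt)
open Summit.QuantumFields.BalabanUV.Beta.D1BFx.LogDetSecondVariation (secondVar)
open Summit.QuantumFields.BalabanUV.Beta.FP.KernelPeriodisationFib (Idx perF perF_apply perZ perZ_apply trF perF_transpose)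
open Summit.QuantumFields.BalabanUV.Beta.FP.TorusCombRows (Res)
open Summit.QuantumFields.BalabanUV.Beta.FP.CompositeWardLetters (compWard_b0 compWard_b1 compWard_b2)
open Summit.QuantumFields.BalabanUV.Beta.FP.RelInvPeriodised (bhKStepAt_translate_invariant)
open Summit.QuantumFields.BalabanUV.Beta.FP.PeriodisedWardOrderZero (bhKStepAt_ff_symm)
open Summit.QuantumFields.BalabanUV.Beta.FP.NestedStepLawTransported (secondVar_nestedFP_eq_zero)
open Summit.QuantumFields.BalabanUV.Beta.FP.NestedStepLawTransportedExpGraded (secondVar_oneShot_nestedStepLaw_expTransported_graded_of_uni)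
open Summit.QuantumFields.BalabanUV.Beta.FP.TorusCompositeObjects (towerTorus towerTorus_apply compRows nestedSlice NParam Qstep combF bigP towerGen)
open Summit.QuantumFields.BalabanUV.Beta.FP.TorusCompositeUnimodular (det_bigP_mul_towerGen_ne_zero)
open Summit.QuantumFields.BalabanUV.Beta.FP.TorusCompositeFP (evalN torus_uP_exp_tower)
open Summit.QuantumFields.BalabanUV.Beta.GAN24.FineReadoutCauchyFrame (toSite_mem_range)
open AffineAveraging (unitVec)
open Summit.QuantumFields.BalabanUV.Beta.FP.TorusEffFormComposite (torus_composite_inv_and_eff)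
open Summit.QuantumFields.BalabanUV.Beta.FP.RelInvPeriodisedCoarse (det_kkt_smul_form_ne_zero_iff)
open Summit.QuantumFields.BalabanUV.Beta.FP.RelInvPeriodisedCombRows (torus_isUnit_det_kkt_combRows)
open Summit.QuantumFields.BalabanUV.Beta.FP.RelInvPeriodisedEffFormCoarse (wVH_pos)
open Literature.Probability.LatticeModels (Torus.proj)
open BalabanStepJetsSucc (wVH)
open Finset
open Summit.QuantumFields.BalabanUV.Beta.FP.TorusCompositeObjectsG (StepRows compRowsG nestedSliceG QstepSym QSym compRowsSym nestedSliceSym compRows_eq_compRowsG nestedSlice_eq_nestedSliceG)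
open Summit.QuantumFields.BalabanUV.Beta.FP.TorusEffFormCompositeG (torus_composite_inv_and_eff_G)
open Summit.QuantumFields.BalabanUV.Beta.FP.NestedStepLawTorusComposite (H₀_transpose_of_dvd dvd_towerTorus_succ secondVar_oneShot_nestedStepLaw_torus_composite_graded)
open Summit.QuantumFields.BalabanUV.Beta.SymShiftedSpread (bhKStepSh)
open Summit.QuantumFields.BalabanUV.Beta.DshAn1 (Dsh)
open Summit.QuantumFields.BalabanUV.Beta.FP.RelInvPeriodisedCombTorusLetters (torus_h1_comb hId_comb torus_H₀_transpose_comb)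
open Summit.QuantumFields.BalabanUV.Beta.FP.RelInvPeriodisedEffFormCoarse (hId_order_zero_record)
open Summit.QuantumFields.BalabanUV.Beta.FP.RelInvPeriodisedCombRecord (torus_isUnit_det_kkt_combRows_comb)
open Summit.QuantumFields.BalabanUV.Beta.FP.TorusGaugeCovarianceCoarse (coarsePt coarsePt_coe)
open Summit.QuantumFields.BalabanUV.Beta.FP.NestedStepLawTorusInstance (coarseSlot_injective coarseSlot_range torus_h1)
open AveragingContoursRooted (ctrOff ctrOff_mem_box)
open ExpKernelCalculus (MKer)

variable {d : ℕ}

/-! ## §1 The graded torus call, generic over the step-row family `Q` and the form family `K` -/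

section CompositeG

variable (M' : Fin (d + 1) → ℕ) [∀ μ, NeZero (M' μ)] (Lc : ℕ) [NeZero Lc] (lev : ℕ → ℕ) (rs : ℕ → (Fin (d + 1) → ℕ)) (n : ℕ)

set_option synthInstance.maxSize 1024 in
/-- [folklore] **THE GRADED TORUS CALL AT FINE := THE `(n+1)`-FOLD COMPOSITE, GENERIC OVER `(Q, K)` — #19 `secondVar_oneShot_nestedStepLaw_torus_composite_graded`
with the pins over leaf-06's `compRowsG Lc Q ∕ nestedSliceG Lc Q` and the abstract form family `K`, the three brick inputs DISPLAYED (`hH₀t`; leaf-05's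
(h1)ₖ ∕ (hId)ₖ letters `hone ∕ hId`; the top step's comb-sliced KKT `htop` over ABSTRACT `Q₂₀ ∕ τ₂`), every other binder and the conclusion VERBATIM.**
(INV-m) and (EFF-m) follow inside by leaf-05's `torus_composite_inv_and_eff_G` + `det_kkt_smul_form_ne_zero_iff`. -/
theorem secondVar_oneShot_nestedStepLaw_torus_composite_graded_G (Q : StepRows d Lc) (K : ℕ → (Fin (d + 1) → ℕ) → MKer (d + 1) (Fib d))
    (hlev : ∀ i, lev i = lev (i + 1) + 1)
    -- the top step's multiplier index type (abstract; at the instances: (B)'s slot presentation one level above `M′`)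
    {κ : Type*} [Fintype κ] [DecidableEq κ]
    -- the composite objects PINNED over the abstract families: finest form `K (lev (n+1)) (rs (n+1))`, rows `compRowsG Lc Q`, nested slice `nestedSliceG Lc Q`
    {H₀ : Matrix (↥(pbox (towerTorus Lc M' (n + 1))) × Fin (d + 1)) (↥(pbox (towerTorus Lc M' (n + 1))) × Fin (d + 1)) ℝ}
    {Q₁₀ : Matrix (↥(pbox M') × Fin (d + 1)) (↥(pbox (towerTorus Lc M' (n + 1))) × Fin (d + 1)) ℝ}
    {τ₁ : Matrix (NParam Lc (fine Lc M') (fun k => rs (k + 1)) n) (↥(pbox (towerTorus Lc M' (n + 1))) × Fin (d + 1)) ℝ}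
    (hH₀ : H₀ = (perF (towerTorus Lc M' (n + 1)) (K (lev (n + 1)) (rs (n + 1)))).submatrix
        (fun b : ↥(pbox (towerTorus Lc M' (n + 1))) × Fin (d + 1) => ((b.1, Sum.inl b.2) : Idx (towerTorus Lc M' (n + 1)) (Fib d)))
        (fun b : ↥(pbox (towerTorus Lc M' (n + 1))) × Fin (d + 1) => ((b.1, Sum.inl b.2) : Idx (towerTorus Lc M' (n + 1)) (Fib d))))
    (hQ₁₀ : Q₁₀ = compRowsG Lc Q M' lev rs (n + 1))
    (hτ₁ : τ₁ = nestedSliceG Lc Q (fine Lc M') (fun k => lev (k + 1)) (fun k => rs (k + 1)) n)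
    -- DISPLAYED BRICK INPUTS (discharged per instance): the finest form block is symmetric; leaf-05's one-step letters (h1)ₖ ∕ (hId)ₖ at every storey
    (hH₀t : H₀ᵀ = H₀)
    (hone : ∀ (k : ℕ) (T : Fin (d + 1) → ℕ) [∀ μ, NeZero (T μ)],
      (kkt ((perF (fine Lc T) (K (lev k) (rs k))).submatrix
            (fun b : ↥(pbox (fine Lc T)) × Fin (d + 1) => ((b.1, Sum.inl b.2) : Idx (fine Lc T) (Fib d)))
            (fun b : ↥(pbox (fine Lc T)) × Fin (d + 1) => ((b.1, Sum.inl b.2) : Idx (fine Lc T) (Fib d))))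
        (fromRows (Q T (lev k) (rs k)) (combF Lc (fine Lc T) (rs k)))).det ≠ 0)
    (hId : ∀ (k : ℕ) (T : Fin (d + 1) → ℕ) [∀ μ, NeZero (T μ)] (r' : Fin (d + 1) → ℕ),
      (effForm ((perF (fine Lc T) (K (lev k) (rs k))).submatrix
            (fun b : ↥(pbox (fine Lc T)) × Fin (d + 1) => ((b.1, Sum.inl b.2) : Idx (fine Lc T) (Fib d)))
            (fun b : ↥(pbox (fine Lc T)) × Fin (d + 1) => ((b.1, Sum.inl b.2) : Idx (fine Lc T) (Fib d))))
          (fromRows (Q T (lev k) (rs k)) (combF Lc (fine Lc T) (rs k)))).toBlocks₁₁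
        = (wVH d Lc (lev k + 1))⁻¹ • (perF T (K (lev k + 1) r')).submatrix
            (fun b : ↥(pbox T) × Fin (d + 1) => ((b.1, Sum.inl b.2) : Idx T (Fib d)))
            (fun b : ↥(pbox T) × Fin (d + 1) => ((b.1, Sum.inl b.2) : Idx T (Fib d))))
    (τ₂ : Matrix (Res (toSite (rs 0)) Lc M') (↥(pbox M') × Fin (d + 1)) ℝ)
    -- the top step's averaging rows and comb slice ABSTRACT; its comb-sliced KKT non-degeneracy over the form `K (lev 0) (rs 0)` DISPLAYED (`htop`)
    (Q₂₀ : Matrix κ (↥(pbox M') × Fin (d + 1)) ℝ)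
    (htop : (kkt ((perF M' (K (lev 0) (rs 0))).submatrix (fun b : ↥(pbox M') × Fin (d + 1) => ((b.1, Sum.inl b.2) : Idx M' (Fib d)))
        (fun b : ↥(pbox M') × Fin (d + 1) => ((b.1, Sum.inl b.2) : Idx M' (Fib d)))) (fromRows Q₂₀ τ₂)).det ≠ 0)
    -- the tower's generators and the one-shot big comb: FREE matrices of the tower's types in v1 (pinned to leaf-06's `towerGen ∕ bigP` by the (SLICE-m) ∕
    -- (COV-m) suppliers in v1.1; target shape 36f428fe4d8b64c2)
    (W₀ : Matrix (↥(pbox (towerTorus Lc M' (n + 1))) × Fin (d + 1)) (NParam Lc M' rs (n + 1)) ℝ)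
    (P : Matrix (NParam Lc M' rs (n + 1)) (↥(pbox (towerTorus Lc M' (n + 1))) × Fin (d + 1)) ℝ)
    -- the displayed jets: form (finest level), composite averaging, the top step's averaging jets, generators, witnesses, composite covariance images
    (H₁ H₂ : Matrix (↥(pbox (towerTorus Lc M' (n + 1))) × Fin (d + 1)) (↥(pbox (towerTorus Lc M' (n + 1))) × Fin (d + 1)) ℝ)
    (Q₁₁ Q₁₂ : Matrix (↥(pbox M') × Fin (d + 1)) (↥(pbox (towerTorus Lc M' (n + 1))) × Fin (d + 1)) ℝ)
    (Q₂₁ Q₂₂ : Matrix κ (↥(pbox M') × Fin (d + 1)) ℝ)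
    (W₁ W₂ : Matrix (↥(pbox (towerTorus Lc M' (n + 1))) × Fin (d + 1)) (NParam Lc M' rs (n + 1)) ℝ)
    (Dbar Db₁ Db₂ : Matrix (↥(pbox M') × Fin (d + 1)) (Res (toSite (rs 0)) Lc M') ℝ)
    (Y₀ Y₁ Y₂ : Matrix κ (NParam Lc M' rs (n + 1)) ℝ)
    -- the chart transport (exponential currency): generators `X` (finest fields), `X̄` (coarse multipliers); one-shot chart's generator jets; parameter-transport jets
    (X : Matrix (↥(pbox (towerTorus Lc M' (n + 1))) × Fin (d + 1)) (↥(pbox (towerTorus Lc M' (n + 1))) × Fin (d + 1)) ℝ) (Xbar : Matrix κ κ ℝ)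
    (W'₁ W'₂ : Matrix (↥(pbox (towerTorus Lc M' (n + 1))) × Fin (d + 1)) (NParam Lc M' rs (n + 1)) ℝ)
    (C₁ C₂ : Matrix (NParam Lc M' rs (n + 1)) (NParam Lc M' rs (n + 1)) ℝ)
    {𝔔₀ 𝔔₁ 𝔔₂ : Matrix κ (↥(pbox (towerTorus Lc M' (n + 1))) × Fin (d + 1)) ℝ}
    (h𝔔₀ : Q₂₀ * Q₁₀ = 𝔔₀) (h𝔔₁ : Q₂₁ * Q₁₀ + Q₂₀ * Q₁₁ = 𝔔₁) (h𝔔₂ : Q₂₂ * Q₁₀ + Q₂₁ * Q₁₁ + (Q₂₁ * Q₁₁ + Q₂₀ * Q₁₂) = 𝔔₂)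
    -- (T-β-m) GRADED: the one-shot literal's composite jets are the graded `X`-conjugated words, NAMED
    {H'₁ H'₂ : Matrix (↥(pbox (towerTorus Lc M' (n + 1))) × Fin (d + 1)) (↥(pbox (towerTorus Lc M' (n + 1))) × Fin (d + 1)) ℝ}
    {𝔔'₁ 𝔔'₂ : Matrix κ (↥(pbox (towerTorus Lc M' (n + 1))) × Fin (d + 1)) ℝ}
    (k1 : -(Xᵀ * H₀) + H₁ + H₀ * X = H'₁)
    (k2 : (X * X)ᵀ * H₀ + (-(Xᵀ * H₁) + -(Xᵀ * H₀ * X)) + ((-(Xᵀ * H₁) + -(Xᵀ * H₀ * X)) + (H₂ + H₁ * X + (H₁ * X + H₀ * (X * X)))) = H'₂)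
    (q1 : Xbar * 𝔔₀ + 𝔔₁ + 𝔔₀ * X = 𝔔'₁)
    (q2 : Xbar * Xbar * 𝔔₀ + (Xbar * 𝔔₁ + Xbar * 𝔔₀ * X) + ((Xbar * 𝔔₁ + Xbar * 𝔔₀ * X) + (𝔔₂ + 𝔔₁ * X + (𝔔₁ * X + 𝔔₀ * (X * X)))) = 𝔔'₂)
    (j1 : -X * W₀ + W₁ = W'₁ + W₀ * C₁) (j2 : X * X * W₀ + (2 : ℝ) • (-X * W₁) + W₂ = W'₂ + (2 : ℝ) • (W'₁ * C₁) + W₀ * C₂)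
    (uC : secondVar (1 : Matrix (NParam Lc M' rs (n + 1)) (NParam Lc M' rs (n + 1)) ℝ) C₁ C₂ = 0)
    -- (INV-m) `h1` and (EFF-m) `h2` follow INSIDE from `hone hId htop` by leaf-05 `TorusEffFormCompositeG.torus_composite_inv_and_eff_G`
    {Γ : Matrix (↥(pbox (towerTorus Lc M' (n + 1))) × Fin (d + 1)) (↥(pbox (towerTorus Lc M' (n + 1))) × Fin (d + 1)) ℝ}
    {I : Matrix (↥(pbox (towerTorus Lc M' (n + 1))) × Fin (d + 1)) ((↥(pbox M') × Fin (d + 1)) ⊕ NParam Lc (fine Lc M') (fun k => rs (k + 1)) n) ℝ}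
    {L : Matrix ((↥(pbox M') × Fin (d + 1)) ⊕ NParam Lc (fine Lc M') (fun k => rs (k + 1)) n) (↥(pbox (towerTorus Lc M' (n + 1))) × Fin (d + 1)) ℝ}
    {S : Matrix ((↥(pbox M') × Fin (d + 1)) ⊕ NParam Lc (fine Lc M') (fun k => rs (k + 1)) n)
      ((↥(pbox M') × Fin (d + 1)) ⊕ NParam Lc (fine Lc M') (fun k => rs (k + 1)) n) ℝ}
    {B : Matrix ((↥(pbox M') × Fin (d + 1)) ⊕ NParam Lc (fine Lc M') (fun k => rs (k + 1)) n) (↥(pbox (towerTorus Lc M' (n + 1))) × Fin (d + 1)) ℝ}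
    (hΓ : flucCov H₀ (fromRows Q₁₀ τ₁) = Γ) (hI : minOp H₀ (fromRows Q₁₀ τ₁) = I) (hL : minOpL H₀ (fromRows Q₁₀ τ₁) = L) (hS : effForm H₀ (fromRows Q₁₀ τ₁) = S)
    (hB : fromRows Q₁₁ (0 : Matrix (NParam Lc (fine Lc M') (fun k => rs (k + 1)) n) (↥(pbox (towerTorus Lc M' (n + 1))) × Fin (d + 1)) ℝ) = B)
    -- (SLICE-m) the two Faddeev–Popov pairings are non-degenerate; the one-shot chart's (UNI)-jet letter; the nested chart's dead rows
    (hPW : (P * W₀).det ≠ 0) (hTW : (fromRows (τ₂ * Q₁₀) τ₁ * W₀).det ≠ 0)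
    (uP' : secondVar (P * W₀) (P * W'₁) (P * W'₂) = 0) (s1 : τ₁ * W₁ = 0) (s2 : τ₁ * W₂ = 0)
    (t1 : τ₂ * (Q₁₁ * W₀ + Q₁₀ * W₁) = 0) (t2 : τ₂ * (Q₁₂ * W₀ + (2 : ℝ) • (Q₁₁ * W₁) + Q₁₀ * W₂) = 0)
    -- parities of the displayed form jets; the GRADED Ward rows of the finest form against the composite witnesses (NO transposed rows)
    (hH₁t : H₁ᵀ = -H₁) (hH₂t : H₂ᵀ = H₂)
    (a0 : H₀ * W₀ = 𝔔₀ᵀ * Y₀) (a1 : H₁ * W₀ + H₀ * W₁ = -(𝔔₁ᵀ * Y₀) + 𝔔₀ᵀ * Y₁)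
    (a2 : H₂ * W₀ + (2 : ℝ) • (H₁ * W₁) + H₀ * W₂ = 𝔔₂ᵀ * Y₀ + -((2 : ℝ) • (𝔔₁ᵀ * Y₁)) + 𝔔₀ᵀ * Y₂)
    -- (COV-m) the composite covariance rows (orders 0, 1, 2) and the top step's coarse covariance rows
    (c0 : Q₁₀ * W₀ = fromCols Dbar (0 : Matrix (↥(pbox M') × Fin (d + 1)) (NParam Lc (fine Lc M') (fun k => rs (k + 1)) n) ℝ))
    (c1 : Q₁₁ * W₀ + Q₁₀ * W₁ = fromCols Db₁ (0 : Matrix (↥(pbox M') × Fin (d + 1)) (NParam Lc (fine Lc M') (fun k => rs (k + 1)) n) ℝ))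
    (c2 : Q₁₂ * W₀ + (2 : ℝ) • (Q₁₁ * W₁) + Q₁₀ * W₂ = fromCols Db₂ (0 : Matrix (↥(pbox M') × Fin (d + 1)) (NParam Lc (fine Lc M') (fun k => rs (k + 1)) n) ℝ))
    (d0 : Q₂₀ * Dbar = 0) (d1 : Q₂₁ * Dbar + Q₂₀ * Db₁ = 0) (d2 : Q₂₂ * Dbar + (2 : ℝ) • (Q₂₁ * Db₁) + Q₂₀ * Db₂ = 0) :
    secondVar (kkt H₀ (fromRows 𝔔₀ P))
        (fromBlocks H'₁ (-(fromRows 𝔔'₁ (0 : Matrix (NParam Lc M' rs (n + 1)) (↥(pbox (towerTorus Lc M' (n + 1))) × Fin (d + 1)) ℝ))ᵀ)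
          (fromRows 𝔔'₁ (0 : Matrix (NParam Lc M' rs (n + 1)) (↥(pbox (towerTorus Lc M' (n + 1))) × Fin (d + 1)) ℝ)) 0)
        (kkt H'₂ (fromRows 𝔔'₂ (0 : Matrix (NParam Lc M' rs (n + 1)) (↥(pbox (towerTorus Lc M' (n + 1))) × Fin (d + 1)) ℝ)))
      = secondVar (kkt H₀ (fromRows Q₁₀ τ₁)) (fromBlocks H₁ (-Bᵀ) B 0)
            (kkt H₂ (fromRows Q₁₂ (0 : Matrix (NParam Lc (fine Lc M') (fun k => rs (k + 1)) n) (↥(pbox (towerTorus Lc M' (n + 1))) × Fin (d + 1)) ℝ)))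
        + secondVar
            (kkt S.toBlocks₁₁ (fromRows Q₂₀ τ₂))
            (fromBlocks ((L * H₁ - S * B) * I + L * Bᵀ * S).toBlocks₁₁ (-(fromRows Q₂₁ (0 : Matrix (Res (toSite (rs 0)) Lc M') (↥(pbox M') × Fin (d + 1)) ℝ))ᵀ)
              (fromRows Q₂₁ (0 : Matrix (Res (toSite (rs 0)) Lc M') (↥(pbox M') × Fin (d + 1)) ℝ)) 0)
            (kkt (((-((L * H₁ - S * B) * Γ - L * Bᵀ * L) * H₁ + L * H₂
                      - (((L * H₁ - S * B) * I + L * Bᵀ * S) * B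
                          + S * fromRows Q₁₂ (0 : Matrix (NParam Lc (fine Lc M') (fun k => rs (k + 1)) n) (↥(pbox (towerTorus Lc M' (n + 1))) × Fin (d + 1)) ℝ))) * I
                    + (L * H₁ - S * B) * (-((Γ * H₁ + I * B) * I + Γ * Bᵀ * S)))
                  - ((-((L * H₁ - S * B) * Γ - L * Bᵀ * L) * (-Bᵀ)
                        + L * (fromRows Q₁₂ (0 : Matrix (NParam Lc (fine Lc M') (fun k => rs (k + 1)) n) (↥(pbox (towerTorus Lc M' (n + 1))) × Fin (d + 1)) ℝ))ᵀ) * S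
                      + L * (-Bᵀ) * ((L * H₁ - S * B) * I + L * Bᵀ * S))).toBlocks₁₁
              (fromRows Q₂₂ (0 : Matrix (Res (toSite (rs 0)) Lc M') (↥(pbox M') × Fin (d + 1)) ℝ))) := by
  -- `H₀ᵀ = H₀` is DISPLAYED (`hH₀t`); the composite constraint rows from the covariance rows
  have hIE := torus_composite_inv_and_eff_G Lc Q K n M' lev rs hlev hone hId
  have h1 : (kkt H₀ (fromRows Q₁₀ τ₁)).det ≠ 0 := by rw [hH₀, hQ₁₀, hτ₁]; exact hIE.1
  -- (EFF-m): the composite's effective corner is the unit⁻¹-multiple of the top torus's form; the top step is non-degenerate over it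
  have hc : (∏ i ∈ range (n + 1), (wVH d Lc (lev i))⁻¹) ≠ 0 :=
    prod_ne_zero_iff.mpr fun i _ => inv_ne_zero (wVH_pos (Nat.pos_of_ne_zero (NeZero.ne Lc)) (lev i)).ne'
  have h2 : (kkt S.toBlocks₁₁ (fromRows Q₂₀ τ₂)).det ≠ 0 := by
    rw [← hS, hH₀, hQ₁₀, hτ₁, hIE.2 (rs 0), det_kkt_smul_form_ne_zero_iff hc]
    exact htop
  have b0 := compWard_b0 Q₁₀ Q₂₀ W₀ Dbar c0 d0 h𝔔₀
  have b1 := compWard_b1 Q₁₀ Q₁₁ Q₂₀ Q₂₁ W₀ W₁ Dbar Db₁ c0 c1 d1 h𝔔₀ h𝔔₁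
  have b2 := compWard_b2 Q₁₀ Q₁₁ Q₁₂ Q₂₀ Q₂₁ Q₂₂ W₀ W₁ W₂ Dbar Db₁ Db₂ c0 c1 c2 d2 h𝔔₀ h𝔔₁ h𝔔₂
  -- the GRADED transported law (exponential currency; colour lift inside) with `G = 0`
  have h := secondVar_oneShot_nestedStepLaw_expTransported_graded_of_uni H₀ H₁ H₂ Q₁₀ Q₁₁ Q₁₂ Q₂₀ Q₂₁ Q₂₂ 0 0 0 τ₁ τ₂ P W₀ W₁ W₂
    Y₀ Y₁ Y₂ X Xbar W'₁ W'₂ C₁ C₂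
    (show H₀ + Q₁₀ᵀ * (0 : Matrix (↥(pbox M') × Fin (d + 1)) (↥(pbox M') × Fin (d + 1)) ℝ) * Q₁₀ = H₀ by rw [Matrix.mul_zero, Matrix.zero_mul, add_zero])
    (show H₁ + (-(Q₁₁ᵀ * (0 : Matrix (↥(pbox M') × Fin (d + 1)) (↥(pbox M') × Fin (d + 1)) ℝ) * Q₁₀)
        + Q₁₀ᵀ * (0 : Matrix (↥(pbox M') × Fin (d + 1)) (↥(pbox M') × Fin (d + 1)) ℝ) * Q₁₀
        + Q₁₀ᵀ * (0 : Matrix (↥(pbox M') × Fin (d + 1)) (↥(pbox M') × Fin (d + 1)) ℝ) * Q₁₁) = H₁ by simp only [Matrix.mul_zero, Matrix.zero_mul, neg_zero, add_zero])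
    (show H₂ + ((Q₁₂ᵀ * (0 : Matrix (↥(pbox M') × Fin (d + 1)) (↥(pbox M') × Fin (d + 1)) ℝ) * Q₁₀
          + -(Q₁₁ᵀ * (0 : Matrix (↥(pbox M') × Fin (d + 1)) (↥(pbox M') × Fin (d + 1)) ℝ) * Q₁₀)
          + -(Q₁₁ᵀ * (0 : Matrix (↥(pbox M') × Fin (d + 1)) (↥(pbox M') × Fin (d + 1)) ℝ) * Q₁₁))
        + (-(Q₁₁ᵀ * (0 : Matrix (↥(pbox M') × Fin (d + 1)) (↥(pbox M') × Fin (d + 1)) ℝ) * Q₁₀)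
          + Q₁₀ᵀ * (0 : Matrix (↥(pbox M') × Fin (d + 1)) (↥(pbox M') × Fin (d + 1)) ℝ) * Q₁₀
          + Q₁₀ᵀ * (0 : Matrix (↥(pbox M') × Fin (d + 1)) (↥(pbox M') × Fin (d + 1)) ℝ) * Q₁₁)
        + (-(Q₁₁ᵀ * (0 : Matrix (↥(pbox M') × Fin (d + 1)) (↥(pbox M') × Fin (d + 1)) ℝ) * Q₁₁)
          + Q₁₀ᵀ * (0 : Matrix (↥(pbox M') × Fin (d + 1)) (↥(pbox M') × Fin (d + 1)) ℝ) * Q₁₁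
          + Q₁₀ᵀ * (0 : Matrix (↥(pbox M') × Fin (d + 1)) (↥(pbox M') × Fin (d + 1)) ℝ) * Q₁₂)) = H₂ by simp only [Matrix.mul_zero, Matrix.zero_mul, neg_zero, add_zero])
    h𝔔₀ h𝔔₁ h𝔔₂ k1 k2 q1 q2 j1 j2 uC uP' (secondVar_nestedFP_eq_zero τ₁ τ₂ Q₁₀ Q₁₁ Q₁₂ W₀ W₁ W₂ s1 s2 t1 t2)
    hH₀t hH₁t hH₂t a0 a1 a2 b0 b1 b2 hPW hTW hΓ hI hL hS hB h1 (by rw [add_zero]; exact h2)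
  simp only [add_zero] at h
  exact h


set_option synthInstance.maxSize 1024 in
/-- CONSISTENCY (the ROOTED instance IS #19): #19's statement character for character, from §1 at `Q := Qstep Lc`, `K ℓ r := bhKStepAt d (toSite r) Lc ℓ`
(leaf-06 `compRows_eq_compRowsG ∕ nestedSlice_eq_nestedSliceG`, #19 §1 `H₀_transpose_of_dvd`, leaf-05 `torus_h1 ∕ hId_order_zero_record`, `torus_isUnit_det_kkt_combRows`). -/
example (hrs : ∀ k, rs k ∈ box (d + 1) Lc) (hlev : ∀ i, lev i = lev (i + 1) + 1)
    (hM' : ∀ i, Lc ∣ M' i)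
    -- the coarse multipliers' slot presentation one level above `M′` (as (B): injective, `inr`-valued, exactly the `Lc`-coarse sites of `M′`)
    {κ : Type*} [Fintype κ] [DecidableEq κ] (pμ' : κ → ↥(pbox M')) (mμ' : κ → Fin (d + 1))
    (hfμ' : Function.Injective (fun a : κ => ((pμ' a, Sum.inr (mμ' a)) : Idx M' (Fib d))))
    (hcoarse' : ∀ (s : ↥(pbox M')) (m : Fin (d + 1)),
      ((s, Sum.inr m) : Idx M' (Fib d)) ∈ Set.range (fun a : κ => ((pμ' a, Sum.inr (mμ' a)) : Idx M' (Fib d))) ↔ Torus.proj Lc (s : Site (d + 1)) = 0)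
    -- the composite objects of record, PINNED by defining equations (leaf-06 `TorusCompositeObjects`)
    {H₀ : Matrix (↥(pbox (towerTorus Lc M' (n + 1))) × Fin (d + 1)) (↥(pbox (towerTorus Lc M' (n + 1))) × Fin (d + 1)) ℝ}
    {Q₁₀ : Matrix (↥(pbox M') × Fin (d + 1)) (↥(pbox (towerTorus Lc M' (n + 1))) × Fin (d + 1)) ℝ}
    {τ₁ : Matrix (NParam Lc (fine Lc M') (fun k => rs (k + 1)) n) (↥(pbox (towerTorus Lc M' (n + 1))) × Fin (d + 1)) ℝ}
    (hH₀ : H₀ = (perF (towerTorus Lc M' (n + 1)) (bhKStepAt d (toSite (rs (n + 1))) Lc (lev (n + 1)))).submatrix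
        (fun b : ↥(pbox (towerTorus Lc M' (n + 1))) × Fin (d + 1) => ((b.1, Sum.inl b.2) : Idx (towerTorus Lc M' (n + 1)) (Fib d)))
        (fun b : ↥(pbox (towerTorus Lc M' (n + 1))) × Fin (d + 1) => ((b.1, Sum.inl b.2) : Idx (towerTorus Lc M' (n + 1)) (Fib d))))
    (hQ₁₀ : Q₁₀ = compRows Lc M' lev rs (n + 1))
    (hτ₁ : τ₁ = nestedSlice Lc (fine Lc M') (fun k => lev (k + 1)) (fun k => rs (k + 1)) n)
    {τ₂ : Matrix (Res (toSite (rs 0)) Lc M') (↥(pbox M') × Fin (d + 1)) ℝ} (hτ₂ : τ₂ = combF Lc M' (rs 0))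
    -- the top step's averaging rows (level `lev 0`, root `rs 0`), PINNED as (B)'s `hQ₂₀`
    {Q₂₀ : Matrix κ (↥(pbox M') × Fin (d + 1)) ℝ}
    (hQ₂₀ : Q₂₀ = (perF M' (bhKStepAt d (toSite (rs 0)) Lc (lev 0))).submatrix (fun a : κ => ((pμ' a, Sum.inr (mμ' a)) : Idx M' (Fib d)))
        (fun b : ↥(pbox M') × Fin (d + 1) => ((b.1, Sum.inl b.2) : Idx M' (Fib d))))
    -- the tower's generators and the one-shot big comb: FREE matrices of the tower's types in v1 (pinned to leaf-06's `towerGen ∕ bigP` by the (SLICE-m) ∕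
    -- (COV-m) suppliers in v1.1; target shape 36f428fe4d8b64c2)
    (W₀ : Matrix (↥(pbox (towerTorus Lc M' (n + 1))) × Fin (d + 1)) (NParam Lc M' rs (n + 1)) ℝ)
    (P : Matrix (NParam Lc M' rs (n + 1)) (↥(pbox (towerTorus Lc M' (n + 1))) × Fin (d + 1)) ℝ)
    -- the displayed jets: form (finest level), composite averaging, the top step's averaging jets, generators, witnesses, composite covariance images
    (H₁ H₂ : Matrix (↥(pbox (towerTorus Lc M' (n + 1))) × Fin (d + 1)) (↥(pbox (towerTorus Lc M' (n + 1))) × Fin (d + 1)) ℝ)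
    (Q₁₁ Q₁₂ : Matrix (↥(pbox M') × Fin (d + 1)) (↥(pbox (towerTorus Lc M' (n + 1))) × Fin (d + 1)) ℝ)
    (Q₂₁ Q₂₂ : Matrix κ (↥(pbox M') × Fin (d + 1)) ℝ)
    (W₁ W₂ : Matrix (↥(pbox (towerTorus Lc M' (n + 1))) × Fin (d + 1)) (NParam Lc M' rs (n + 1)) ℝ)
    (Dbar Db₁ Db₂ : Matrix (↥(pbox M') × Fin (d + 1)) (Res (toSite (rs 0)) Lc M') ℝ)
    (Y₀ Y₁ Y₂ : Matrix κ (NParam Lc M' rs (n + 1)) ℝ)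
    -- the chart transport (exponential currency): generators `X` (finest fields), `X̄` (coarse multipliers); one-shot chart's generator jets; parameter-transport jets
    (X : Matrix (↥(pbox (towerTorus Lc M' (n + 1))) × Fin (d + 1)) (↥(pbox (towerTorus Lc M' (n + 1))) × Fin (d + 1)) ℝ) (Xbar : Matrix κ κ ℝ)
    (W'₁ W'₂ : Matrix (↥(pbox (towerTorus Lc M' (n + 1))) × Fin (d + 1)) (NParam Lc M' rs (n + 1)) ℝ)
    (C₁ C₂ : Matrix (NParam Lc M' rs (n + 1)) (NParam Lc M' rs (n + 1)) ℝ)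
    {𝔔₀ 𝔔₁ 𝔔₂ : Matrix κ (↥(pbox (towerTorus Lc M' (n + 1))) × Fin (d + 1)) ℝ}
    (h𝔔₀ : Q₂₀ * Q₁₀ = 𝔔₀) (h𝔔₁ : Q₂₁ * Q₁₀ + Q₂₀ * Q₁₁ = 𝔔₁) (h𝔔₂ : Q₂₂ * Q₁₀ + Q₂₁ * Q₁₁ + (Q₂₁ * Q₁₁ + Q₂₀ * Q₁₂) = 𝔔₂)
    -- (T-β-m) GRADED: the one-shot literal's composite jets are the graded `X`-conjugated words, NAMED
    {H'₁ H'₂ : Matrix (↥(pbox (towerTorus Lc M' (n + 1))) × Fin (d + 1)) (↥(pbox (towerTorus Lc M' (n + 1))) × Fin (d + 1)) ℝ}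
    {𝔔'₁ 𝔔'₂ : Matrix κ (↥(pbox (towerTorus Lc M' (n + 1))) × Fin (d + 1)) ℝ}
    (k1 : -(Xᵀ * H₀) + H₁ + H₀ * X = H'₁)
    (k2 : (X * X)ᵀ * H₀ + (-(Xᵀ * H₁) + -(Xᵀ * H₀ * X)) + ((-(Xᵀ * H₁) + -(Xᵀ * H₀ * X)) + (H₂ + H₁ * X + (H₁ * X + H₀ * (X * X)))) = H'₂)
    (q1 : Xbar * 𝔔₀ + 𝔔₁ + 𝔔₀ * X = 𝔔'₁)
    (q2 : Xbar * Xbar * 𝔔₀ + (Xbar * 𝔔₁ + Xbar * 𝔔₀ * X) + ((Xbar * 𝔔₁ + Xbar * 𝔔₀ * X) + (𝔔₂ + 𝔔₁ * X + (𝔔₁ * X + 𝔔₀ * (X * X)))) = 𝔔'₂)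
    (j1 : -X * W₀ + W₁ = W'₁ + W₀ * C₁) (j2 : X * X * W₀ + (2 : ℝ) • (-X * W₁) + W₂ = W'₂ + (2 : ℝ) • (W'₁ * C₁) + W₀ * C₂)
    (uC : secondVar (1 : Matrix (NParam Lc M' rs (n + 1)) (NParam Lc M' rs (n + 1)) ℝ) C₁ C₂ = 0)
    -- (INV-m) `h1` and (EFF-m) `h2` are DISCHARGED inside (leaf-05 `TorusEffFormComposite.torus_composite_inv_and_eff`)
    {Γ : Matrix (↥(pbox (towerTorus Lc M' (n + 1))) × Fin (d + 1)) (↥(pbox (towerTorus Lc M' (n + 1))) × Fin (d + 1)) ℝ}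
    {I : Matrix (↥(pbox (towerTorus Lc M' (n + 1))) × Fin (d + 1)) ((↥(pbox M') × Fin (d + 1)) ⊕ NParam Lc (fine Lc M') (fun k => rs (k + 1)) n) ℝ}
    {L : Matrix ((↥(pbox M') × Fin (d + 1)) ⊕ NParam Lc (fine Lc M') (fun k => rs (k + 1)) n) (↥(pbox (towerTorus Lc M' (n + 1))) × Fin (d + 1)) ℝ}
    {S : Matrix ((↥(pbox M') × Fin (d + 1)) ⊕ NParam Lc (fine Lc M') (fun k => rs (k + 1)) n)
      ((↥(pbox M') × Fin (d + 1)) ⊕ NParam Lc (fine Lc M') (fun k => rs (k + 1)) n) ℝ}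
    {B : Matrix ((↥(pbox M') × Fin (d + 1)) ⊕ NParam Lc (fine Lc M') (fun k => rs (k + 1)) n) (↥(pbox (towerTorus Lc M' (n + 1))) × Fin (d + 1)) ℝ}
    (hΓ : flucCov H₀ (fromRows Q₁₀ τ₁) = Γ) (hI : minOp H₀ (fromRows Q₁₀ τ₁) = I) (hL : minOpL H₀ (fromRows Q₁₀ τ₁) = L) (hS : effForm H₀ (fromRows Q₁₀ τ₁) = S)
    (hB : fromRows Q₁₁ (0 : Matrix (NParam Lc (fine Lc M') (fun k => rs (k + 1)) n) (↥(pbox (towerTorus Lc M' (n + 1))) × Fin (d + 1)) ℝ) = B)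
    -- (SLICE-m) the two Faddeev–Popov pairings are non-degenerate; the one-shot chart's (UNI)-jet letter; the nested chart's dead rows
    (hPW : (P * W₀).det ≠ 0) (hTW : (fromRows (τ₂ * Q₁₀) τ₁ * W₀).det ≠ 0)
    (uP' : secondVar (P * W₀) (P * W'₁) (P * W'₂) = 0) (s1 : τ₁ * W₁ = 0) (s2 : τ₁ * W₂ = 0)
    (t1 : τ₂ * (Q₁₁ * W₀ + Q₁₀ * W₁) = 0) (t2 : τ₂ * (Q₁₂ * W₀ + (2 : ℝ) • (Q₁₁ * W₁) + Q₁₀ * W₂) = 0)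
    -- parities of the displayed form jets; the GRADED Ward rows of the finest form against the composite witnesses (NO transposed rows)
    (hH₁t : H₁ᵀ = -H₁) (hH₂t : H₂ᵀ = H₂)
    (a0 : H₀ * W₀ = 𝔔₀ᵀ * Y₀) (a1 : H₁ * W₀ + H₀ * W₁ = -(𝔔₁ᵀ * Y₀) + 𝔔₀ᵀ * Y₁)
    (a2 : H₂ * W₀ + (2 : ℝ) • (H₁ * W₁) + H₀ * W₂ = 𝔔₂ᵀ * Y₀ + -((2 : ℝ) • (𝔔₁ᵀ * Y₁)) + 𝔔₀ᵀ * Y₂)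
    -- (COV-m) the composite covariance rows (orders 0, 1, 2) and the top step's coarse covariance rows
    (c0 : Q₁₀ * W₀ = fromCols Dbar (0 : Matrix (↥(pbox M') × Fin (d + 1)) (NParam Lc (fine Lc M') (fun k => rs (k + 1)) n) ℝ))
    (c1 : Q₁₁ * W₀ + Q₁₀ * W₁ = fromCols Db₁ (0 : Matrix (↥(pbox M') × Fin (d + 1)) (NParam Lc (fine Lc M') (fun k => rs (k + 1)) n) ℝ))
    (c2 : Q₁₂ * W₀ + (2 : ℝ) • (Q₁₁ * W₁) + Q₁₀ * W₂ = fromCols Db₂ (0 : Matrix (↥(pbox M') × Fin (d + 1)) (NParam Lc (fine Lc M') (fun k => rs (k + 1)) n) ℝ))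
    (d0 : Q₂₀ * Dbar = 0) (d1 : Q₂₁ * Dbar + Q₂₀ * Db₁ = 0) (d2 : Q₂₂ * Dbar + (2 : ℝ) • (Q₂₁ * Db₁) + Q₂₀ * Db₂ = 0) :
    secondVar (kkt H₀ (fromRows 𝔔₀ P))
        (fromBlocks H'₁ (-(fromRows 𝔔'₁ (0 : Matrix (NParam Lc M' rs (n + 1)) (↥(pbox (towerTorus Lc M' (n + 1))) × Fin (d + 1)) ℝ))ᵀ)
          (fromRows 𝔔'₁ (0 : Matrix (NParam Lc M' rs (n + 1)) (↥(pbox (towerTorus Lc M' (n + 1))) × Fin (d + 1)) ℝ)) 0)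
        (kkt H'₂ (fromRows 𝔔'₂ (0 : Matrix (NParam Lc M' rs (n + 1)) (↥(pbox (towerTorus Lc M' (n + 1))) × Fin (d + 1)) ℝ)))
      = secondVar (kkt H₀ (fromRows Q₁₀ τ₁)) (fromBlocks H₁ (-Bᵀ) B 0)
            (kkt H₂ (fromRows Q₁₂ (0 : Matrix (NParam Lc (fine Lc M') (fun k => rs (k + 1)) n) (↥(pbox (towerTorus Lc M' (n + 1))) × Fin (d + 1)) ℝ)))
        + secondVar
            (kkt S.toBlocks₁₁ (fromRows Q₂₀ τ₂))
            (fromBlocks ((L * H₁ - S * B) * I + L * Bᵀ * S).toBlocks₁₁ (-(fromRows Q₂₁ (0 : Matrix (Res (toSite (rs 0)) Lc M') (↥(pbox M') × Fin (d + 1)) ℝ))ᵀ)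
              (fromRows Q₂₁ (0 : Matrix (Res (toSite (rs 0)) Lc M') (↥(pbox M') × Fin (d + 1)) ℝ)) 0)
            (kkt (((-((L * H₁ - S * B) * Γ - L * Bᵀ * L) * H₁ + L * H₂
                      - (((L * H₁ - S * B) * I + L * Bᵀ * S) * B
                          + S * fromRows Q₁₂ (0 : Matrix (NParam Lc (fine Lc M') (fun k => rs (k + 1)) n) (↥(pbox (towerTorus Lc M' (n + 1))) × Fin (d + 1)) ℝ))) * I
                    + (L * H₁ - S * B) * (-((Γ * H₁ + I * B) * I + Γ * Bᵀ * S)))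
                  - ((-((L * H₁ - S * B) * Γ - L * Bᵀ * L) * (-Bᵀ)
                        + L * (fromRows Q₁₂ (0 : Matrix (NParam Lc (fine Lc M') (fun k => rs (k + 1)) n) (↥(pbox (towerTorus Lc M' (n + 1))) × Fin (d + 1)) ℝ))ᵀ) * S
                      + L * (-Bᵀ) * ((L * H₁ - S * B) * I + L * Bᵀ * S))).toBlocks₁₁
              (fromRows Q₂₂ (0 : Matrix (Res (toSite (rs 0)) Lc M') (↥(pbox M') × Fin (d + 1)) ℝ))) := by
  rw [compRows_eq_compRowsG] at hQ₁₀
  rw [nestedSlice_eq_nestedSliceG] at hτ₁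
  exact secondVar_oneShot_nestedStepLaw_torus_composite_graded_G M' Lc lev rs n (fun M _ ℓ r => Qstep Lc M ℓ r)
    (fun ℓ r => bhKStepAt d (toSite r) Lc ℓ) hlev (hH₀ := hH₀) (hQ₁₀ := hQ₁₀) (hτ₁ := hτ₁)
    (hH₀t := H₀_transpose_of_dvd (dvd_towerTorus_succ (Lc := Lc) M' n) (lev (n + 1)) hH₀)
    (hone := fun k T _ => torus_h1 T (hrs k) (lev k))
    (hId := fun k T _ r' => hId_order_zero_record T (hrs k) (lev k) r' (coarsePt T Lc) (coarsePt_coe T Lc) (coarseSlot_injective T) (coarseSlot_range T))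
    (τ₂ := τ₂) (Q₂₀ := Q₂₀)
    (htop := by
      rw [hQ₂₀, hτ₂]
      exact (torus_isUnit_det_kkt_combRows M' (hrs 0) hM' (lev 0) _ hfμ' (fun a => ⟨mμ' a, rfl⟩) hcoarse').ne_zero)
    (W₀ := W₀)
    (P := P)
    (H₁ := H₁)
    (H₂ := H₂)
    (Q₁₁ := Q₁₁)
    (Q₁₂ := Q₁₂)
    (Q₂₁ := Q₂₁)
    (Q₂₂ := Q₂₂)
    (W₁ := W₁)
    (W₂ := W₂)
    (Dbar := Dbar)
    (Db₁ := Db₁)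
    (Db₂ := Db₂)
    (Y₀ := Y₀)
    (Y₁ := Y₁)
    (Y₂ := Y₂)
    (X := X)
    (Xbar := Xbar)
    (W'₁ := W'₁)
    (W'₂ := W'₂)
    (C₁ := C₁)
    (C₂ := C₂)
    (h𝔔₀ := h𝔔₀)
    (h𝔔₁ := h𝔔₁)
    (h𝔔₂ := h𝔔₂)
    (k1 := k1)
    (k2 := k2)
    (q1 := q1)
    (q2 := q2)
    (j1 := j1)
    (j2 := j2)
    (uC := uC)
    (hΓ := hΓ)
    (hI := hI)
    (hL := hL)
    (hS := hS)
    (hB := hB)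
    (hPW := hPW)
    (hTW := hTW)
    (uP' := uP')
    (s1 := s1)
    (s2 := s2)
    (t1 := t1)
    (t2 := t2)
    (hH₁t := hH₁t)
    (hH₂t := hH₂t)
    (a0 := a0)
    (a1 := a1)
    (a2 := a2)
    (c0 := c0)
    (c1 := c1)
    (c2 := c2)
    (d0 := d0)
    (d1 := d1)
    (d2 := d2)

end CompositeG

end Summit.QuantumFields.BalabanUV.Beta.FP.NestedStepLawTorusCompositeG

end
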